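import Literature.Analysis.Fourier.HilbertTransformCircleSeries
import Literature.Analysis.ValidatedNumerics.WeightedEllOneFourierAlgebra
import HarnessLib

/-!
# The CAP operator `hilb_s2c` IS the periodic Hilbert transform: `H (sinEval s) = cosEval (hilbS2C s)`

Topic `Literature/Analysis/Fourier`. The computer-assisted-proof vocabulary of the tree
(`Literature/Analysis/ValidatedNumerics/WeightedEllOneFourierAlgebra.lean`: sine/cosine coefficient sequences, `sinEval`,
`cosEval`, and the cap operator `hilbS2C s k = if k = 0 then 0 else −s k` — "the periodic Hilbert transform on a sine series,
`sin(mx) ↦ −cos(mx)`, coefficientwise") is tied to the ANALYTIC operator `hilbertTransformCircle` of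
`HilbertTransformCircle.lean` (p.v. cot kernel): for every sine coefficient sequence with a finite first moment
`Σ_m m|s_m| < ∞` — in particular every member of the weighted space `ℓ¹_ν`, `ν > 1`, of the certificates —

  `hilbertTransformCircle (sinEval s) = cosEval (hilbS2C s)`.

[cite: Grafakos2014, Ex. 4.1.4(c) (the conjugate function acts as `−i sgn k` on Fourier coefficients)] So a certified statement
about `hilbS2C` of a certified sine profile (the OSW / viscous-sheet radii-polynomial rows) is a statement about the genuine
Hilbert transform of the profile function. Proof: index shift `k ↦ k+1` and `hilbertTransformCircle_tsum`. No new definition.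
-/

namespace Literature.Analysis.Fourier

open _root_.MeasureTheory Set Filter
open Literature.Analysis.ValidatedNumerics.WeightedEllOne
open scoped Real Topology

/-- In `ℓ¹_ν` with `ν > 1` the first moment `Σ_m m|s_m|` converges (`1 + m(ν−1) ≤ ν^m`, Bernoulli). [folklore] -/
private theorem summable_mul_abs_of_mem {ν : ℝ} (hν : 1 < ν) {s : ℕ → ℝ} (hs : Mem ν s) :
    Summable fun m : ℕ => (m : ℝ) * |s m| := by
  have hν1 : 0 < ν - 1 := by linarith
  refine Summable.of_nonneg_of_le (fun m => by positivity) (fun m => ?_) (hs.mul_left (1 / (ν - 1)))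
  have hb : 1 + (m : ℝ) * (ν - 1) ≤ ν ^ m := by
    have := one_add_mul_le_pow (a := ν - 1) (by linarith) m
    simpa using this
  have hm : (m : ℝ) ≤ ν ^ m / (ν - 1) := by
    rw [le_div_iff₀ hν1]; linarith
  calc (m : ℝ) * |s m| ≤ ν ^ m / (ν - 1) * |s m| := by gcongr
    _ = 1 / (ν - 1) * (|s m| * ν ^ m) := by ring

/-- **`H (sinEval s) = cosEval (hilbS2C s)`**: for a sine coefficient sequence with `Σ_m m|s_m| < ∞`, the periodic Hilbert transform
of `x ↦ Σ_m s_m sin(mx)` is `x ↦ Σ_{m≥1} (−s_m) cos(mx)` — the cap operator `hilb_s2c` is the analytic conjugate-function operator.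
[cite: Grafakos2014, Ex. 4.1.4(c)] -/
theorem hilbertTransformCircle_sinEval {s : ℕ → ℝ} (hs : Summable fun m : ℕ => (m : ℝ) * |s m|) (x : ℝ) :
    hilbertTransformCircle (sinEval s) x = cosEval (hilbS2C s) x := by
  -- index shift: the `m = 0` terms vanish on both sides
  have hs1 : Summable fun k : ℕ => ((k : ℝ) + 1) * (|s (k + 1)| + |(0 : ℝ)|) := by
    have h := (summable_nat_add_iff 1).2 hs
    refine h.congr fun k => ?_
    push_cast
    simp
  have habs : Summable fun m : ℕ => |s m| := by
    refine Summable.of_norm_bounded_eventually_nat (g := fun m : ℕ => (m : ℝ) * |s m|) hs ?_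
    filter_upwards [Filter.eventually_ge_atTop 1] with m hm
    rw [Real.norm_eq_abs, abs_abs]
    have : (1 : ℝ) ≤ m := by exact_mod_cast hm
    calc |s m| = 1 * |s m| := (one_mul _).symm
      _ ≤ (m : ℝ) * |s m| := by gcongr
  have hsin : ∀ y : ℝ, Summable fun m : ℕ => s m * Real.sin (m * y) := fun y =>
    Summable.of_norm_bounded habs fun m => by
      rw [Real.norm_eq_abs, abs_mul]
      exact (mul_le_mul_of_nonneg_left (Real.abs_sin_le_one _) (abs_nonneg _)).trans (by rw [mul_one])
  have hcos : Summable fun m : ℕ => hilbS2C s m * Real.cos (m * x) :=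
    Summable.of_norm_bounded habs fun m => by
      rw [Real.norm_eq_abs, abs_mul]
      have h1 : |hilbS2C s m| ≤ |s m| := by unfold hilbS2C; split_ifs <;> simp
      calc |hilbS2C s m| * |Real.cos (m * x)| ≤ |s m| * 1 :=
            mul_le_mul h1 (Real.abs_cos_le_one _) (abs_nonneg _) (abs_nonneg _)
        _ = |s m| := mul_one _
  have hfun : sinEval s = fun y => ∑' k : ℕ, (s (k + 1) * Real.sin (((k + 1 : ℕ) : ℝ) * y) + 0 * Real.cos (((k + 1 : ℕ) : ℝ) * y)) := by
    funext y
    unfold sinEval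
    rw [(hsin y).tsum_eq_zero_add]
    simp
  rw [hfun, hilbertTransformCircle_tsum hs1 x]
  unfold cosEval
  rw [hcos.tsum_eq_zero_add]
  simp only [hilbS2C, if_true, Nat.cast_zero, zero_mul, Real.cos_zero, zero_add, Nat.succ_ne_zero, if_false]
  refine tsum_congr fun k => ?_
  push_cast
  ring

/-- The same for members of the certificates' weighted space `ℓ¹_ν`, `ν > 1` (every coefficient sequence of an analytic sine profile):
`hilbertTransformCircle (sinEval s) = cosEval (hilbS2C s)` as functions. [cite: Grafakos2014, Ex. 4.1.4(c)] -/
theorem hilbertTransformCircle_sinEval_of_mem {ν : ℝ} (hν : 1 < ν) {s : ℕ → ℝ} (hs : Mem ν s) :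
    hilbertTransformCircle (sinEval s) = cosEval (hilbS2C s) :=
  funext fun x => hilbertTransformCircle_sinEval (summable_mul_abs_of_mem hν hs) x

end Literature.Analysis.Fourier
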